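import Literature.NumberTheory.LFunctions.ExceptionalZeroSimple
import Literature.NumberTheory.LFunctions.SiegelAbelSummation
import HarnessLib

/-!
# `L(1, χ)` against `L'(1, χ)` in the presence of an exceptional zero:
# `L(1, χ) = (1 − β₁) L'(1, χ) (1 + O(1/η))` for a real zero `β₁ = 1 − 1/(η log q)` of large quality

Topic `Literature/NumberTheory/LFunctions`. Everything in this file is PROVED (theorems only).

Let `χ` be a quadratic character modulo `q ≥ 2`, `χ ≠ χ₀`, and suppose `L(s, χ)` has the real zero
`β₁ = 1 − 1/(η log q)`. From Montgomery–Vaughan's Lemma 11.1 (the tree's Lemma-α package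
`Literature.NumberTheory.LFunctions.DirichletZFR.exists_logDeriv_package`, at height `0`):
`L'/L(σ, χ) = ∑_ρ m(ρ)/(σ − ρ) + O(log q)` near `σ = 1` (and the weighted-term inequality
`Literature.NumberTheory.LFunctions.DirichletZFR.mul_re_inv_le_re_sum` of `ExceptionalZeroSimple.lean`), we prove

* `inv_le_of_two_le_multiplicity` — if the package multiplicity of a real zero `β₁` is `≥ 2` then
  `1/(6(1 − β₁)) ≤ K₀ + E log 4q` (MV Theorem 11.3, Case 4 with a double zero:
  `2/(σ − β₁) ≤ 1/(σ − 1) + O(log q)` at `σ = 1 + 2(1 − β₁)`), so for `η` large the zero is simple;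
* `re_sum_erase_le` — the contribution of the other zeros at `σ = 1` is `≪ log q` once each of
  them has `1 − Re ρ ≥ κ ≍ 1/log q`;
* `deriv_LFunction_ofReal_im_eq_zero` — `L'(σ, χ)` is real for real `σ > 0`;
* `exists_abs_sub_le_div_eta` — **the main result**: there are absolute `C, η₀ > 0` such that for
  all such `q, χ` and all `η ≥ η₀` with `L(1 − 1/(η log q), χ) = 0`,
  `|(1 − β₁) L'(1, χ) − L(1, χ)| ≤ (C/η) L(1, χ)`, together with `L(1, χ) > 0`, `L'(1, χ)` real.
  Proof: `L'/L(1, χ) − 1/(1 − β₁) = ψ(1) + ∑_{ρ ≠ β₁} m(ρ)/(1 − ρ)`; the right side is real,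
  `≥ −E log 4q` (each `Re 1/(1 − ρ) ≥ 0`) and `≤ E log 4q + (1 + λ/κ)(1/λ + K₀ + E log 4q)` with
  `λ = κ = c/(log q + log 5)`, because every zero `ρ ≠ β₁` of the package has
  `1 − Re ρ ≥ κ` (MV Theorem 11.3: complex zeros by `DirichletZFR.exists_zeroFree`, real ones by
  Page's `DirichletZFR.exists_min_realZeros_le`), so `Re 1/(1 − ρ) ≤ (1 + λ/κ) Re 1/(1 + λ − ρ)`,
  and `∑_ρ m(ρ) Re 1/(1 + λ − ρ) = Re L'/L(1 + λ) − Re ψ(1 + λ) ≤ 1/λ + K₀ + E log 4q`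
  (`DirichletZFR.exists_norm_logDeriv_le`). Hence `|L'/L(1,χ) − 1/(1 − β₁)| ≪ log q`, and
  multiplying by `(1 − β₁) L(1, χ) = L(1, χ)/(η log q)` gives the claim.

This is the input "`(L'/L)(1, χ) ≍ η log q_χ`" of Tao–Teräväinen's treatment of Siegel zeros
(J. London Math. Soc. 106 (2022), §3) in the precise asymptotic form needed for
Granville–Mollin's Proposition 2 (`Literature.Barriers.Parity.GranvilleMollin2000_prop2`).

## References

* H. L. Montgomery, R. C. Vaughan, *Multiplicative Number Theory I. Classical Theory*, CUP 2007,
  §11.1 Lemma 11.1, Theorem 11.3 (proof, Case 4) [MontgomeryVaughan2007].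
* T. Tao, J. Teräväinen, *The Hardy–Littlewood–Chowla conjecture in the presence of a Siegel
  zero*, J. London Math. Soc. (2) 106 (2022), §3 [TaoTeravainen2021].
-/

noncomputable section

open Complex Filter Topology Metric Set Finset
open scoped LSeries.notation ArithmeticFunction.vonMangoldt

namespace Literature.NumberTheory.LFunctions.ExceptionalZero

open Literature.NumberTheory.LFunctions.DirichletZFR

/-! ## Elementary lemmas on the sum over zeros -/

/-- Each term of `∑_{a ∈ S} m(a)/(s − a)` has non-negative real part when `Re a < Re s`.
[folklore] -/
theorem re_div_sub_nonneg {m : ℂ → ℕ} {s a : ℂ} (h : a.re < s.re) :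
    0 ≤ ((m a : ℂ) / (s - a)).re := by
  rw [div_eq_mul_inv, show ((m a : ℕ) : ℂ) = ((m a : ℝ) : ℂ) by simp, Complex.re_ofReal_mul]
  refine mul_nonneg (Nat.cast_nonneg _) ?_
  rw [Complex.inv_re]
  exact div_nonneg (by simp; linarith) (Complex.normSq_nonneg _)

/-- `Re ((m a)/(s − a)) = m(a) · Re (s − a)⁻¹`. [folklore] -/
theorem re_div_sub_eq (m : ℂ → ℕ) (s a : ℂ) :
    ((m a : ℂ) / (s - a)).re = (m a : ℝ) * ((s - a)⁻¹).re := by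
  rw [div_eq_mul_inv, show ((m a : ℕ) : ℂ) = ((m a : ℝ) : ℂ) by simp, Complex.re_ofReal_mul]

/-- Splitting off one zero: `∑_{a ∈ S} = m(ρ)/(s − ρ) + ∑_{a ∈ S \ {ρ}}`. [folklore] -/
theorem sum_div_eq_add_sum_erase {S : Finset ℂ} (m : ℂ → ℕ) (s : ℂ) {ρ : ℂ} (hρ : ρ ∈ S) :
    ∑ a ∈ S, (m a : ℂ) / (s - a) = (m ρ : ℂ) / (s - ρ) + ∑ a ∈ S.erase ρ, (m a : ℂ) / (s - a) :=
  (Finset.add_sum_erase S (fun a ↦ (m a : ℂ) / (s - a)) hρ).symm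

/-- Comparison of `Re 1/(1 − ρ)` and `Re 1/(1 + λ − ρ)` for a zero at horizontal distance
`1 − Re ρ ≥ κ > 0` from `σ = 1`: `Re (1 − ρ)⁻¹ ≤ (1 + λ/κ) Re (1 + λ − ρ)⁻¹` (`λ ≥ 0`).
[folklore] -/
theorem re_inv_one_sub_le {ρ : ℂ} {κ lam : ℝ} (hκ : 0 < κ) (hlam : 0 ≤ lam) (hρ : κ ≤ 1 - ρ.re) :
    ((1 - ρ)⁻¹).re ≤ (1 + lam / κ) * ((((1 + lam : ℝ) : ℂ) - ρ)⁻¹).re := by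
  set a : ℝ := 1 - ρ.re with ha
  set g : ℝ := ρ.im with hg
  have ha0 : 0 < a := lt_of_lt_of_le hκ hρ
  have h1 : (1 - ρ) = ((a : ℝ) : ℂ) + ((-g : ℝ) : ℂ) * I := by
    apply Complex.ext <;> simp [ha, hg]
  have h2 : (((1 + lam : ℝ) : ℂ) - ρ) = ((a + lam : ℝ) : ℂ) + ((-g : ℝ) : ℂ) * I := by
    apply Complex.ext <;> simp [ha, hg]; ring
  rw [h1, h2, re_inv_ofReal_add_mul_I, re_inv_ofReal_add_mul_I]
  have hal : 0 < a + lam := by linarith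
  have hD1 : 0 < a ^ 2 + (-g) ^ 2 := by positivity
  have hD2 : 0 < (a + lam) ^ 2 + (-g) ^ 2 := by positivity
  rw [div_le_iff₀ hD1, show (1 + lam / κ) * ((a + lam) / ((a + lam) ^ 2 + (-g) ^ 2)) *
      (a ^ 2 + (-g) ^ 2) = (1 + lam / κ) * (a + lam) * (a ^ 2 + (-g) ^ 2) / ((a + lam) ^ 2 + (-g) ^ 2)
      by ring, le_div_iff₀ hD2]
  -- `a ((a+λ)² + g²) ≤ (1 + λ/κ)(a + λ)(a² + g²)`: since `a + λ ≤ (1 + λ/κ) a` (as `κ ≤ a`)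
  have hkey : a + lam ≤ (1 + lam / κ) * a := by
    rw [add_mul, one_mul, div_mul_eq_mul_div, add_le_add_iff_left, le_div_iff₀ hκ]
    exact mul_le_mul_of_nonneg_left hρ hlam
  have hg2 : 0 ≤ (-g) ^ 2 := sq_nonneg _
  -- `a (a+λ)² ≤ (1+λ/κ) a (a+λ) · a`? No: compare termwise.
  -- LHS = a (a+λ)² + a g²;  RHS = (1+λ/κ)(a+λ) a² + (1+λ/κ)(a+λ) g².
  have t1 : a * (a + lam) ^ 2 ≤ (1 + lam / κ) * (a + lam) * a ^ 2 := by
    have := mul_le_mul_of_nonneg_left hkey (by positivity : 0 ≤ a * (a + lam))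
    nlinarith
  have t2 : a * (-g) ^ 2 ≤ (1 + lam / κ) * (a + lam) * (-g) ^ 2 := by
    refine mul_le_mul_of_nonneg_right ?_ hg2
    have h1' : a ≤ a + lam := by linarith
    have h2' : (1 : ℝ) ≤ 1 + lam / κ := by
      have := div_nonneg hlam hκ.le; linarith
    nlinarith
  nlinarith

/-! ## `L'(σ, χ)` is real on the real axis -/

/-- For a quadratic character `χ ≠ 1` and real `σ > 0`, `L'(σ, χ)` is real (since `L(x, χ)` is
real for real `x > 0`, `Literature.NumberTheory.LFunctions.DirichletAbel.LFunction_ofReal_im_eq_zero`).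
[folklore] -/
theorem deriv_LFunction_ofReal_im_eq_zero {q : ℕ} [NeZero q] (χ : DirichletCharacter ℂ q)
    (hχ : χ ≠ 1) (hq : χ ^ 2 = 1) {σ : ℝ} (hσ : 0 < σ) :
    (deriv χ.LFunction (σ : ℂ)).im = 0 := by
  have him : HasDerivAt (fun x : ℝ => (χ.LFunction (x : ℂ)).im) (deriv χ.LFunction (σ : ℂ)).im σ := by
    have hd' : HasDerivAt (fun s : ℂ => -I * χ.LFunction s) (-I * deriv χ.LFunction (σ : ℂ)) (σ : ℂ) :=
      ((DirichletCharacter.differentiable_LFunction hχ (σ : ℂ)).hasDerivAt).const_mul (-I)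
    have h := hd'.real_of_complex
    have hre : ∀ w : ℂ, (-I * w).re = w.im := fun w ↦ by simp [Complex.mul_re]
    simp only [hre] at h
    exact h
  have hzero : HasDerivAt (fun x : ℝ => (χ.LFunction (x : ℂ)).im) 0 σ := by
    refine (hasDerivAt_const σ (0 : ℝ)).congr_of_eventuallyEq ?_
    filter_upwards [Ioi_mem_nhds hσ] with x hx
    exact Literature.NumberTheory.LFunctions.DirichletAbel.LFunction_ofReal_im_eq_zero χ hχ hq hx
  exact him.unique hzero

/-- `L(1, χ)` is real and positive for a quadratic `χ ≠ 1`. [folklore] -/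
theorem LFunction_one_re_pos_im_zero {q : ℕ} [NeZero q] (χ : DirichletCharacter ℂ q)
    (hχ : χ ≠ 1) (hq : χ ^ 2 = 1) :
    0 < (χ.LFunction 1).re ∧ (χ.LFunction 1).im = 0 := by
  have h1 : ((1 : ℝ) : ℂ) = 1 := by simp
  constructor
  · have := Literature.NumberTheory.LFunctions.DirichletAbel.LFunction_ofReal_re_pos_of_forall_ne_zero
      χ hχ hq (σ₀ := 1) one_pos le_rfl (fun σ h1σ hσ1 ↦ by
        have hσ : σ = 1 := le_antisymm hσ1 h1σ
        subst hσ
        exact DirichletCharacter.LFunction_ne_zero_of_one_le_re χ (Or.inl hχ) (by simp))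
    rwa [h1] at this
  · have := Literature.NumberTheory.LFunctions.DirichletAbel.LFunction_ofReal_im_eq_zero χ hχ hq
      (σ := 1) one_pos
    rwa [h1] at this

/-! ## Consequences of the Lemma-α package at height `0` -/

section Package

variable {q : ℕ} [NeZero q] (χ : DirichletCharacter ℂ q) {S : Finset ℂ} {m : ℂ → ℕ} {ψ : ℂ → ℂ}
  {B : ℝ}

/-- Real points `1 + u`, `0 ≤ u ≤ 21/128`, lie in the disc `|z − 17/16| ≤ 13/128`. [folklore] -/
theorem one_add_mem_closedBall {u : ℝ} (hu0 : 0 ≤ u) (hu1 : u ≤ 21 / 128) :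
    ((1 + u : ℝ) : ℂ) ∈ closedBall (17 / 16 : ℂ) (13 / 128) := by
  rw [mem_closedBall_iff_norm]
  have : ((1 + u : ℝ) : ℂ) - 17 / 16 = ((u - 1 / 16 : ℝ) : ℂ) := by push_cast; ring
  rw [this, Complex.norm_real, Real.norm_eq_abs, abs_le]
  constructor <;> linarith

/-- … and in the disc `|z − 17/16| < 13/32`. [folklore] -/
theorem one_add_mem_ball {u : ℝ} (hu0 : 0 ≤ u) (hu1 : u ≤ 21 / 128) :
    ((1 + u : ℝ) : ℂ) ∈ ball (17 / 16 : ℂ) (13 / 32) :=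
  mem_ball_iff_norm.2 (lt_of_le_of_lt (mem_closedBall_iff_norm.1 (one_add_mem_closedBall hu0 hu1))
    (by norm_num))

/-- `Re (1 + u − b)⁻¹ = 1/(1 + u − b)` for real `u, b`. [folklore] -/
theorem re_inv_one_add_sub (u b : ℝ) : ((((1 + u : ℝ) : ℂ) - (b : ℂ))⁻¹).re = 1 / (1 + u - b) := by
  have : ((1 + u : ℝ) : ℂ) - (b : ℂ) = ((1 + u - b : ℝ) : ℂ) := by push_cast; ring
  rw [this, ← Complex.ofReal_inv, Complex.ofReal_re, one_div]

/-- The package identity at a real point `1 + u`, `0 ≤ u ≤ 21/128`: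
`L'/L(1 + u, χ) = ψ(1 + u) + ∑_{a ∈ S} m(a)/(1 + u − a)`. [cite: MontgomeryVaughan2007, Lemma 11.1] -/
theorem logDeriv_one_add_eq (hχ : χ ≠ 1)
    (hψ : ∀ z ∈ ball (17 / 16 : ℂ) (13 / 32), χ.LFunction z ≠ 0 →
      ψ z = deriv χ.LFunction z / χ.LFunction z - ∑ a ∈ S, (m a : ℂ) / (z - a))
    {u : ℝ} (hu0 : 0 ≤ u) (hu1 : u ≤ 21 / 128) :
    deriv χ.LFunction ((1 + u : ℝ) : ℂ) / χ.LFunction ((1 + u : ℝ) : ℂ) =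
      ψ ((1 + u : ℝ) : ℂ) + ∑ a ∈ S, (m a : ℂ) / (((1 + u : ℝ) : ℂ) - a) := by
  have hne : χ.LFunction ((1 + u : ℝ) : ℂ) ≠ 0 :=
    DirichletCharacter.LFunction_ne_zero_of_one_le_re χ (Or.inl hχ) (by simp; linarith)
  rw [hψ _ (one_add_mem_ball hu0 hu1) hne]; ring

/-- Zeros of `L(s, χ)`, `χ ≠ χ₀`, have real part `< 1` (Mathlib). [folklore] -/
theorem re_lt_one_of_zero (hχ : χ ≠ 1) {a : ℂ} (ha : χ.LFunction a = 0) : a.re < 1 := by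
  by_contra hcon
  exact DirichletCharacter.LFunction_ne_zero_of_one_le_re χ (Or.inl hχ) (not_lt.1 hcon) ha

/-- **A double zero is not exceptional** (MV Theorem 11.3, Case 4, for a multiple zero): if the
real zero `β ∈ S` (with `1 − β ≤ 21/256`) has package multiplicity `m(β) ≥ 2`, then
`1/(6(1 − β)) ≤ K₀ + B`, where `−ζ'/ζ(σ) ≤ 1/(σ − 1) + K₀` and `|ψ| ≤ B` on the small disc: at
`σ = 1 + 2(1 − β)`, `0 ≤ −ζ'/ζ(σ) − Re L'/L(σ, χ) ≤ 1/(2(1−β)) + K₀ + B − 2/(3(1 − β))`.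
[cite: MontgomeryVaughan2007, Theorem 11.3 (proof, Case 4)] -/
theorem inv_le_of_two_le_multiplicity (hχ : χ ≠ 1) {K₀ : ℝ}
    (hK : ∀ σ : ℝ, 1 < σ → σ ≤ 2 → Summable (fun n : ℕ ↦ Λ n / (n : ℝ) ^ σ) ∧
      ∑' n : ℕ, Λ n / (n : ℝ) ^ σ ≤ 1 / (σ - 1) + K₀)
    (hS : ∀ a ∈ S, χ.LFunction a = 0 ∧ 0 < m a ∧ ‖a - 17 / 16‖ ≤ 13 / 32)
    (hψ : ∀ z ∈ ball (17 / 16 : ℂ) (13 / 32), χ.LFunction z ≠ 0 →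
      ψ z = deriv χ.LFunction z / χ.LFunction z - ∑ a ∈ S, (m a : ℂ) / (z - a))
    (hψb : ∀ z ∈ closedBall (17 / 16 : ℂ) (13 / 128), ‖ψ z‖ ≤ B)
    {β : ℝ} (hβS : (β : ℂ) ∈ S) (hβ1 : β < 1) (hβsmall : 1 - β ≤ 21 / 256)
    (hm : 2 ≤ m (β : ℂ)) : 1 / (6 * (1 - β)) ≤ K₀ + B := by
  set u : ℝ := 1 - β with hu
  have hu0 : 0 < u := by rw [hu]; linarith
  set d : ℝ := 2 * u with hddef
  have hdpos : 0 < d := by positivity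
  have hd1 : d ≤ 21 / 128 := by rw [hddef]; linarith
  -- (11.2)(i) and (11.4)
  have hA := re_LSeries_vonMangoldt_le hK hdpos (by linarith)
  have h114 := one_add_re_nonneg χ (σ := 1 + d) (by linarith)
  -- the package: `Re L(χΛ, 1+d) ≤ B − 2/(1+d−β)`
  have hs1 : 1 < (((1 + d : ℝ) : ℂ)).re := by simp; linarith
  have hSre : ∀ a ∈ S, a.re < (((1 + d : ℝ) : ℂ)).re := by
    intro a ha
    have := re_lt_one_of_zero χ hχ (hS a ha).1
    simp only [Complex.ofReal_re]; linarith
  have hP : (L (↗χ * ↗Λ) ((1 + d : ℝ) : ℂ)).re ≤ B - 2 * (1 / (1 + d - β)) := by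
    rw [← neg_logDeriv_LFunction_eq χ hs1, logDeriv_one_add_eq χ hχ hψ hdpos.le hd1,
      Complex.neg_re, Complex.add_re]
    have hsum := mul_re_inv_le_re_sum (m := m) hSre hβS
    rw [re_inv_one_add_sub] at hsum
    have hpos : 0 ≤ 1 / (1 + d - β) := div_nonneg zero_le_one (by rw [hddef, hu]; linarith)
    have hm2 : (2 : ℝ) ≤ m (β : ℂ) := by exact_mod_cast hm
    have h2 : 2 * (1 / (1 + d - β)) ≤ (m (β : ℂ) : ℝ) * (1 / (1 + d - β)) :=
      mul_le_mul_of_nonneg_right hm2 hpos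
    have hψ' := (Complex.abs_re_le_norm _).trans (hψb _ (one_add_mem_closedBall hdpos.le hd1))
    linarith [neg_abs_le (ψ ((1 + d : ℝ) : ℂ)).re, le_abs_self (ψ ((1 + d : ℝ) : ℂ)).re]
  -- combine
  have h3 : 1 + d - β = 3 * u := by rw [hddef, hu]; ring
  rw [h3] at hP
  have hd2 : 1 / d = 1 / (2 * u) := by rw [hddef]
  rw [hd2] at hA
  have e : 1 / (6 * u) = 2 * (1 / (3 * u)) - 1 / (2 * u) := by field_simp; norm_num
  rw [e]
  linarith

/-- **The other zeros at `σ = 1`**: if every zero `a ≠ ρ` of the package satisfies `1 − Re a ≥ κ`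
(`0 < κ ≤ 21/128`), then `∑_{a ∈ S, a ≠ ρ} m(a) Re 1/(1 − a) ≤ 2 (1/κ + K₀ + B)`, comparing with
`σ₁ = 1 + κ` where `∑_{a ∈ S} m(a) Re 1/(σ₁ − a) = Re L'/L(σ₁, χ) − Re ψ(σ₁) ≤ 1/κ + K₀ + B`.
[cite: MontgomeryVaughan2007, Lemma 11.1] -/
theorem re_sum_erase_le (hχ : χ ≠ 1) {K₀ : ℝ}
    (hKχ : ∀ s : ℂ, 1 < s.re → ‖deriv χ.LFunction s / χ.LFunction s‖ ≤ 1 / (min s.re 2 - 1) + K₀)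
    (hS : ∀ a ∈ S, χ.LFunction a = 0 ∧ 0 < m a ∧ ‖a - 17 / 16‖ ≤ 13 / 32)
    (hψ : ∀ z ∈ ball (17 / 16 : ℂ) (13 / 32), χ.LFunction z ≠ 0 →
      ψ z = deriv χ.LFunction z / χ.LFunction z - ∑ a ∈ S, (m a : ℂ) / (z - a))
    (hψb : ∀ z ∈ closedBall (17 / 16 : ℂ) (13 / 128), ‖ψ z‖ ≤ B)
    {ρ : ℂ} {κ : ℝ} (hκ0 : 0 < κ) (hκ1 : κ ≤ 21 / 128) (hfar : ∀ a ∈ S.erase ρ, κ ≤ 1 - a.re) :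
    (∑ a ∈ S.erase ρ, (m a : ℂ) / (1 - a)).re ≤ 2 * (1 / κ + K₀ + B) := by
  have hSre : ∀ a ∈ S, a.re < (((1 + κ : ℝ) : ℂ)).re := by
    intro a ha
    have := re_lt_one_of_zero χ hχ (hS a ha).1
    simp only [Complex.ofReal_re]; linarith
  -- at `σ₁ = 1 + κ`
  have hσ₁ : (∑ a ∈ S, (m a : ℂ) / (((1 + κ : ℝ) : ℂ) - a)).re ≤ 1 / κ + K₀ + B := by
    have hs1 : 1 < (((1 + κ : ℝ) : ℂ)).re := by simp; linarith
    have heq : ∑ a ∈ S, (m a : ℂ) / (((1 + κ : ℝ) : ℂ) - a) =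
        deriv χ.LFunction ((1 + κ : ℝ) : ℂ) / χ.LFunction ((1 + κ : ℝ) : ℂ) -
          ψ ((1 + κ : ℝ) : ℂ) := by
      rw [logDeriv_one_add_eq χ hχ hψ hκ0.le hκ1]; ring
    rw [heq, Complex.sub_re]
    have h1 := (Complex.abs_re_le_norm _).trans (hKχ ((1 + κ : ℝ) : ℂ) hs1)
    have hmin : min (((1 + κ : ℝ) : ℂ)).re 2 - 1 = κ := by
      simp only [Complex.ofReal_re]
      rw [min_eq_left (by linarith)]; ring
    rw [hmin] at h1
    have h2 := (Complex.abs_re_le_norm _).trans (hψb _ (one_add_mem_closedBall hκ0.le hκ1))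
    linarith [le_abs_self ((deriv χ.LFunction ((1 + κ : ℝ) : ℂ) / χ.LFunction ((1 + κ : ℝ) : ℂ))).re,
      neg_abs_le (ψ ((1 + κ : ℝ) : ℂ)).re]
  -- termwise comparison
  have hterm : ∀ a ∈ S.erase ρ, ((m a : ℂ) / (1 - a)).re ≤
      2 * ((m a : ℂ) / (((1 + κ : ℝ) : ℂ) - a)).re := by
    intro a ha
    rw [re_div_sub_eq, re_div_sub_eq]
    have h := re_inv_one_sub_le (lam := κ) hκ0 hκ0.le (hfar a ha)
    rw [div_self hκ0.ne'] at h
    have hm0 : (0 : ℝ) ≤ m a := Nat.cast_nonneg _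
    have := mul_le_mul_of_nonneg_left h hm0
    linarith
  rw [Complex.re_sum]
  calc ∑ a ∈ S.erase ρ, ((m a : ℂ) / (1 - a)).re
      ≤ ∑ a ∈ S.erase ρ, 2 * ((m a : ℂ) / (((1 + κ : ℝ) : ℂ) - a)).re := sum_le_sum hterm
    _ ≤ ∑ a ∈ S, 2 * ((m a : ℂ) / (((1 + κ : ℝ) : ℂ) - a)).re := by
        refine sum_le_sum_of_subset_of_nonneg (erase_subset _ _) fun a ha _ ↦ ?_
        exact mul_nonneg zero_le_two (re_div_sub_nonneg (hSre a ha))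
    _ = 2 * (∑ a ∈ S, (m a : ℂ) / (((1 + κ : ℝ) : ℂ) - a)).re := by
        rw [Complex.re_sum, mul_sum]
    _ ≤ 2 * (1 / κ + K₀ + B) := by gcongr

end Package

/-! ## The main estimate -/

/-- **`L(1, χ) = (1 − β₁) L'(1, χ)(1 + O(1/η))` for an exceptional zero of quality `η`.** There are
absolute constants `C, η₀ > 0` such that for every quadratic character `χ ≠ χ₀` modulo `q ≥ 2`
and every `η ≥ η₀` for which `β₁ = 1 − 1/(η log q)` is a zero of `L(s, χ)`:
`|(1 − β₁) L'(1, χ) − L(1, χ)| ≤ (C/η) · L(1, χ)` (here `L(1, χ) > 0` and `L'(1, χ)` is real,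
`LFunction_one_re_pos_im_zero`, `deriv_LFunction_ofReal_im_eq_zero`). Proof: MV Lemma 11.1 at
height `0` and MV Theorem 11.3 (all cases), as described in the module docstring.
[cite: MontgomeryVaughan2007, Lemma 11.1 and Theorem 11.3] -/
theorem exists_abs_sub_le_div_eta :
    ∃ C η₀ : ℝ, 0 < C ∧ 0 < η₀ ∧ ∀ (q : ℕ) [NeZero q] (χ : DirichletCharacter ℂ q), χ ≠ 1 →
      χ ^ 2 = 1 → 2 ≤ q → ∀ η : ℝ, η₀ ≤ η →
        χ.LFunction ((1 - 1 / (η * Real.log q) : ℝ) : ℂ) = 0 →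
          |1 / (η * Real.log q) * (deriv χ.LFunction 1).re - (χ.LFunction 1).re| ≤
            C / η * (χ.LFunction 1).re := by
  obtain ⟨K₀, hK₀, hK, hKχ⟩ := exists_norm_logDeriv_le
  obtain ⟨E, hE, hpackage⟩ := exists_logDeriv_package
  obtain ⟨cZ, hcZ, hZF⟩ := exists_zeroFree
  obtain ⟨cP, hcP, hPage⟩ := exists_min_realZeros_le
  -- the constant governing the horizontal distance of the other zeros from `σ = 1`
  set c : ℝ := min (min cZ cP) (1 / 8) with hcdef
  have hc0 : 0 < c := lt_min (lt_min hcZ hcP) (by norm_num)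
  have hcZ' : c ≤ cZ := (min_le_left _ _).trans (min_le_left _ _)
  have hcP' : c ≤ cP := (min_le_left _ _).trans (min_le_right _ _)
  have hc8 : c ≤ 1 / 8 := min_le_right _ _
  -- the constants
  set C : ℝ := 9 * E + 8 / c + 4 * K₀ + 1 with hCdef
  have hCpos : 0 < C := by rw [hCdef]; positivity
  set η₀ : ℝ := 256 / (21 * Real.log 2) + 3 / cP + 6 * (2 * K₀ + 3 * E) + 1 with hη₀def
  have hlog2 : (1 : ℝ) / 2 < Real.log 2 := by
    have := Real.log_two_gt_d9; linarith
  have hη₀pos : 0 < η₀ := by rw [hη₀def]; positivity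
  refine ⟨C, η₀, hCpos, hη₀pos, fun q _ χ hχ hχ2 hq η hη hzero ↦ ?_⟩
  -- unpack the thresholds on `η`
  have g1 : 0 < 256 / (21 * Real.log 2) := by positivity
  have g2 : 0 ≤ 3 / cP := by positivity
  have g3 : 0 ≤ 6 * (2 * K₀ + 3 * E) := by positivity
  have hη1 : 256 / (21 * Real.log 2) ≤ η := by linarith
  have hη2 : 3 / cP < η := by linarith
  have hη3 : 6 * (2 * K₀ + 3 * E) < η := by linarith
  have hη0 : 0 < η := by linarith
  -- `Lq = log q`, `ℒ = log q + log 4`, `ℒ₅ = log q + log 5`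
  set Lq : ℝ := Real.log q with hLq
  have hq2 : (2 : ℝ) ≤ q := by exact_mod_cast hq
  have hLq2 : Real.log 2 ≤ Lq := Real.log_le_log two_pos hq2
  have hLq0 : 0 < Lq := by linarith
  have h2Lq : 1 ≤ 2 * Lq := by linarith
  have hlog4 : Real.log 4 = 2 * Real.log 2 := by
    rw [show (4 : ℝ) = 2 ^ 2 by norm_num, Real.log_pow]; ring
  have hlog5 : Real.log 5 ≤ 3 * Real.log 2 := by
    rw [← Real.log_rpow two_pos, show (2 : ℝ) ^ (3 : ℝ) = 8 by norm_num]
    exact Real.log_le_log (by norm_num) (by norm_num)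
  have hlog45 : Real.log 4 ≤ Real.log 5 := Real.log_le_log (by norm_num) (by norm_num)
  have hlog5pos : 0 < Real.log 5 := Real.log_pos (by norm_num)
  set ℒ : ℝ := Lq + Real.log 4 with hℒdef
  have hℒ3 : ℒ ≤ 3 * Lq := by rw [hℒdef]; linarith
  have hℒ0 : 0 < ℒ := by rw [hℒdef, hlog4]; linarith
  set ℒ₅ : ℝ := Lq + Real.log 5 with hℒ₅def
  have hℒ₅4 : ℒ₅ ≤ 4 * Lq := by rw [hℒ₅def]; linarith
  have hℒ₅0 : 0 < ℒ₅ := by rw [hℒ₅def]; linarith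
  have hℒℒ₅ : ℒ ≤ ℒ₅ := by rw [hℒdef, hℒ₅def]; linarith
  -- `dβ = 1 − β₁ = 1/(η log q)`
  set dβ : ℝ := 1 / (η * Lq) with hdβdef
  have hdβ0 : 0 < dβ := by positivity
  have hηL : 0 < η * Lq := by positivity
  have hdβη : dβ * Lq = 1 / η := by rw [hdβdef]; field_simp
  have hdβle : dβ ≤ 1 / (η * Real.log 2) :=
    div_le_div_of_nonneg_left zero_le_one (by positivity) (by gcongr)
  have hdβsmall : dβ ≤ 21 / 256 := by
    refine hdβle.trans ?_
    rw [div_le_iff₀ (by positivity)]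
    have := (div_le_iff₀ (by positivity : (0:ℝ) < 21 * Real.log 2)).mp hη1
    linarith
  set β : ℝ := 1 - dβ with hβdef
  have hβarg : ((1 - 1 / (η * Real.log q) : ℝ) : ℂ) = (β : ℂ) := by rw [hβdef, hdβdef]
  rw [hβarg] at hzero
  have hβ1 : β < 1 := by rw [hβdef]; linarith
  have hβ21 : 21 / 32 ≤ β := by rw [hβdef]; linarith
  have h1β : 1 - β ≤ 21 / 256 := by rw [hβdef]; linarith
  -- `β > 1 − cP/ℒ`
  have hβPage : 1 - cP / (Real.log q + Real.log 4) < β := by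
    rw [hβdef]
    suffices h : dβ < cP / ℒ by rw [hℒdef] at h; linarith
    rw [hdβdef, div_lt_div_iff₀ hηL hℒ0, one_mul]
    calc ℒ ≤ 3 * Lq := hℒ3
      _ = (3 / cP) * (cP * Lq) := by field_simp
      _ < η * (cP * Lq) := mul_lt_mul_of_pos_right hη2 (by positivity)
      _ = cP * (η * Lq) := by ring
  -- the package at height `0`
  obtain ⟨S, m, ψ, hS, hS', hψ, hψb⟩ := hpackage q χ hχ 0
  have hcen : (17 / 16 + ((0 : ℝ) : ℂ) * I : ℂ) = (17 / 16 : ℂ) := by simp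
  simp only [hcen, abs_zero, zero_add] at hS hS' hψ hψb
  have hψb' : ∀ z ∈ closedBall (17 / 16 : ℂ) (13 / 128), ‖ψ z‖ ≤ E * ℒ := by
    intro z hz; rw [hℒdef]; exact hψb z hz
  -- `β ∈ S`
  have hβS : (β : ℂ) ∈ S := by
    refine hS' _ hzero ?_
    have : (β : ℂ) - 17 / 16 = ((β - 17 / 16 : ℝ) : ℂ) := by push_cast; ring
    rw [this, Complex.norm_real, Real.norm_eq_abs, abs_le]
    constructor <;> linarith
  ----------------------------------------------------------------
  -- Step 1: the multiplicity of `β` in the package is `1`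
  ----------------------------------------------------------------
  have hmβ : m (β : ℂ) = 1 := by
    have hmpos : 0 < m (β : ℂ) := (hS _ hβS).2.1
    by_contra hne
    have hkey := inv_le_of_two_le_multiplicity χ hχ hK hS hψ hψb' hβS hβ1 h1β (by omega)
    -- `1/(6 dβ) = η Lq/6` and `K₀ + Eℒ ≤ (2K₀ + 3E) Lq`
    have hlhs : 1 / (6 * (1 - β)) = η * Lq / 6 := by rw [hβdef, hdβdef]; field_simp; ring
    have hrhs : K₀ + E * ℒ ≤ (2 * K₀ + 3 * E) * Lq := by
      have h1 : K₀ ≤ 2 * K₀ * Lq := by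
        calc K₀ = K₀ * 1 := (mul_one _).symm
          _ ≤ K₀ * (2 * Lq) := mul_le_mul_of_nonneg_left h2Lq hK₀
          _ = 2 * K₀ * Lq := by ring
      have h2 : E * ℒ ≤ 3 * E * Lq := by
        calc E * ℒ ≤ E * (3 * Lq) := mul_le_mul_of_nonneg_left hℒ3 hE
          _ = 3 * E * Lq := by ring
      linarith
    rw [hlhs] at hkey
    have h' : η * Lq ≤ 6 * (2 * K₀ + 3 * E) * Lq := by linarith
    have hη' := le_of_mul_le_mul_right h' hLq0
    linarith
  ----------------------------------------------------------------
  -- Step 2: every other zero of the package has `1 − Re a ≥ κ = c/ℒ₅`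
  ----------------------------------------------------------------
  set κ : ℝ := c / ℒ₅ with hκdef
  have hκ0 : 0 < κ := by positivity
  have hℒ₅1 : 1 ≤ ℒ₅ := by
    rw [hℒ₅def]
    have h5 : (1 : ℝ) ≤ Real.log 5 := by
      rw [Real.le_log_iff_exp_le (by norm_num)]
      exact le_trans (le_of_lt Real.exp_one_lt_d9) (by norm_num)
    linarith
  have hκ21 : κ ≤ 21 / 128 := by
    rw [hκdef]
    calc c / ℒ₅ ≤ c / 1 := div_le_div_of_nonneg_left hc0.le one_pos hℒ₅1
      _ ≤ 21 / 128 := by rw [div_one]; linarith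
  have hfar : ∀ a ∈ S.erase (β : ℂ), κ ≤ 1 - a.re := by
    intro a ha
    obtain ⟨hane, haS⟩ := Finset.mem_erase.mp ha
    have hLa := (hS a haS).1
    have hanorm := (hS a haS).2.2
    rcases eq_or_ne a.im 0 with him | him
    · -- a real zero `≠ β`: Page
      have hare : a = ((a.re : ℝ) : ℂ) := by
        apply Complex.ext <;> simp [him]
      have hLa' : χ.LFunction (a.re : ℂ) = 0 := by rw [← hare]; exact hLa
      have hne : β ≠ a.re := by
        intro h; apply hane; rw [hare, ← h]
      have hmin := hPage q χ hχ β a.re hzero hLa' hne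
      have hale : a.re ≤ 1 - cP / (Real.log q + Real.log 4) := by
        rcases le_total β a.re with h | h
        · rw [min_eq_left h] at hmin; linarith
        · rw [min_eq_right h] at hmin; exact hmin
      have : κ ≤ cP / (Real.log q + Real.log 4) := by
        rw [hκdef, show Real.log q + Real.log 4 = ℒ from rfl]
        calc c / ℒ₅ ≤ c / ℒ := div_le_div_of_nonneg_left hc0.le hℒ0 hℒℒ₅
          _ ≤ cP / ℒ := div_le_div_of_nonneg_right hcP' hℒ0.le
      linarith
    · -- a complex zero: the zero-free region
      have hale : a.re ≤ 1 - cZ / (Real.log q + Real.log (|a.im| + 4)) := by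
        by_contra hcon
        exact him (hZF q χ hχ a hLa (not_le.mp hcon)).2
      have haim : |a.im| ≤ 1 := by
        have h1 : |(a - 17 / 16).im| ≤ ‖a - 17 / 16‖ := Complex.abs_im_le_norm _
        have h2 : (a - 17 / 16 : ℂ).im = a.im := by simp
        rw [h2] at h1
        linarith
      have hlogim : Real.log (|a.im| + 4) ≤ Real.log 5 :=
        Real.log_le_log (by positivity) (by linarith)
      have hden : 0 < Real.log q + Real.log (|a.im| + 4) := by
        have := Real.log_pos (by linarith [abs_nonneg a.im] : (1:ℝ) < |a.im| + 4)
        show 0 < Lq + Real.log (|a.im| + 4)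
        linarith
      have : κ ≤ cZ / (Real.log q + Real.log (|a.im| + 4)) := by
        rw [hκdef]
        calc c / ℒ₅ ≤ c / (Real.log q + Real.log (|a.im| + 4)) :=
              div_le_div_of_nonneg_left hc0.le hden (by show Lq + _ ≤ ℒ₅; rw [hℒ₅def]; linarith)
          _ ≤ cZ / (Real.log q + Real.log (|a.im| + 4)) :=
              div_le_div_of_nonneg_right hcZ' hden.le
      linarith
  ----------------------------------------------------------------
  -- Step 3: the sum over the other zeros at `σ = 1` is `≪ log q`
  ----------------------------------------------------------------
  have hother := re_sum_erase_le χ hχ (hKχ q χ) hS hψ hψb' hκ0 hκ21 hfar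
  have hother0 : 0 ≤ (∑ a ∈ S.erase (β : ℂ), (m a : ℂ) / (1 - a)).re := by
    rw [Complex.re_sum]
    refine sum_nonneg fun a ha ↦ re_div_sub_nonneg ?_
    simp only [Complex.one_re]
    exact re_lt_one_of_zero χ hχ (hS a (Finset.mem_of_mem_erase ha)).1
  ----------------------------------------------------------------
  -- Step 4: `L'/L(1) = 1/dβ + R` with `|R| ≤ C log q`
  ----------------------------------------------------------------
  have hone : ((1 : ℝ) : ℂ) = 1 := by simp
  obtain ⟨hL1pos, hL1im⟩ := LFunction_one_re_pos_im_zero χ hχ hχ2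
  have hL'im : (deriv χ.LFunction 1).im = 0 := by
    have := deriv_LFunction_ofReal_im_eq_zero χ hχ hχ2 (σ := 1) one_pos
    rwa [hone] at this
  -- the identity at `1`
  have hid : deriv χ.LFunction 1 / χ.LFunction 1 =
      ψ 1 + (1 : ℂ) / (1 - (β : ℂ)) + ∑ a ∈ S.erase (β : ℂ), (m a : ℂ) / (1 - a) := by
    have h := logDeriv_one_add_eq χ hχ hψ (u := 0) le_rfl (by norm_num)
    simp only [add_zero, hone] at h
    rw [h, sum_div_eq_add_sum_erase m 1 hβS, hmβ, Nat.cast_one]; ring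
  have hquot : (deriv χ.LFunction 1 / χ.LFunction 1).re =
      (deriv χ.LFunction 1).re / (χ.LFunction 1).re := by
    obtain ⟨a, ha⟩ : ∃ a : ℝ, χ.LFunction 1 = a :=
      ⟨(χ.LFunction 1).re, by apply Complex.ext <;> simp [hL1im]⟩
    obtain ⟨b, hb⟩ : ∃ b : ℝ, deriv χ.LFunction 1 = b :=
      ⟨(deriv χ.LFunction 1).re, by apply Complex.ext <;> simp [hL'im]⟩
    rw [ha, hb, ← Complex.ofReal_div, Complex.ofReal_re, Complex.ofReal_re, Complex.ofReal_re]
  have hβterm : ((1 : ℂ) / (1 - (β : ℂ))).re = 1 / dβ := by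
    have : (1 : ℂ) - (β : ℂ) = ((dβ : ℝ) : ℂ) := by rw [hβdef]; push_cast; ring
    rw [this, ← Complex.ofReal_one, ← Complex.ofReal_div, Complex.ofReal_re]
  set R : ℝ := (ψ 1).re + (∑ a ∈ S.erase (β : ℂ), (m a : ℂ) / (1 - a)).re with hRdef
  have hRid : (deriv χ.LFunction 1).re / (χ.LFunction 1).re = 1 / dβ + R := by
    have h := congrArg Complex.re hid
    rw [hquot, Complex.add_re, Complex.add_re, hβterm] at h
    rw [h, hRdef]; ring
  have hψ1 : |(ψ 1).re| ≤ E * ℒ := by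
    have := (Complex.abs_re_le_norm _).trans (hψb' _ (one_add_mem_closedBall (u := 0) le_rfl (by norm_num)))
    simpa only [add_zero, hone] using this
  have hRbound : |R| ≤ C * Lq := by
    have hκinv : 1 / κ = ℒ₅ / c := by rw [hκdef, one_div_div]
    have hup : R ≤ E * ℒ + 2 * (1 / κ + K₀ + E * ℒ) := by
      rw [hRdef]; linarith [le_abs_self (ψ 1).re]
    have hlow : -(E * ℒ) ≤ R := by
      rw [hRdef]; linarith [neg_abs_le (ψ 1).re]
    have hEℒ : E * ℒ ≤ 3 * E * Lq := by
      calc E * ℒ ≤ E * (3 * Lq) := mul_le_mul_of_nonneg_left hℒ3 hE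
        _ = 3 * E * Lq := by ring
    have hK₀' : K₀ ≤ 2 * K₀ * Lq := by
      calc K₀ = K₀ * 1 := (mul_one _).symm
        _ ≤ K₀ * (2 * Lq) := mul_le_mul_of_nonneg_left h2Lq hK₀
        _ = 2 * K₀ * Lq := by ring
    have hκ' : 1 / κ ≤ (4 / c) * Lq := by
      rw [hκinv]
      calc ℒ₅ / c ≤ (4 * Lq) / c := div_le_div_of_nonneg_right hℒ₅4 hc0.le
        _ = 4 / c * Lq := by ring
    have hCL : E * ℒ + 2 * (1 / κ + K₀ + E * ℒ) ≤ C * Lq := by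
      have hC' : C * Lq = 9 * E * Lq + (8 / c) * Lq + 4 * K₀ * Lq + Lq := by rw [hCdef]; ring
      have h8 : 2 * (4 / c * Lq) = 8 / c * Lq := by ring
      rw [hC']
      linarith
    have hpos2 : 0 ≤ 2 * (1 / κ + K₀ + E * ℒ) := by positivity
    rw [abs_le]; constructor <;> linarith
  ----------------------------------------------------------------
  -- Step 5: conclusion
  ----------------------------------------------------------------
  have hfinal : 1 / (η * Real.log q) * (deriv χ.LFunction 1).re - (χ.LFunction 1).re =
      dβ * (χ.LFunction 1).re * R := by
    have h : (deriv χ.LFunction 1).re = (χ.LFunction 1).re * (1 / dβ + R) := by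
      rw [← hRid]; field_simp
    rw [h, show 1 / (η * Real.log q) = dβ from rfl]
    field_simp
    ring
  rw [hfinal, abs_mul, abs_mul, abs_of_pos hdβ0, abs_of_pos hL1pos]
  calc dβ * (χ.LFunction 1).re * |R| ≤ dβ * (χ.LFunction 1).re * (C * Lq) := by gcongr
    _ = (dβ * Lq) * C * (χ.LFunction 1).re := by ring
    _ = C / η * (χ.LFunction 1).re := by rw [hdβη]; ring

end Literature.NumberTheory.LFunctions.ExceptionalZero
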